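/-
Copyright (c) 2026 the pub-hodgecm-mathlib formalisation cell (harness21).  Prover seat hodgecm-mathlib-K2E3-p17 (g11), HCML Track B «K2-LIT» ∕ h413
(`stmt-HodgeConjecture-24833`), R90-TF section S3, (U3-F) brick P3a «the SPREAD MODEL: real-rootedness with a PINNED constant term under a perturbation of
prescribed size» (dealer R90-C12-plan (g2) RECONCILIATION 2026-09-05T00:40:15Z: P3a+P3b → K2E3-p17; design = captain's census (C3) = audit1 S3#71 (C)).
2026-09-05.
-/
import Summits.HodgeConjecture.HodgeConjecture.Theorems.R90S3RealRootedOfSignAlternation   -- ★ T3 (K2E3-p21): the model alternates; signs survive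
import HarnessLib

/-!
# R90-TF · S3 · THEOREMS — `R90S3SpreadModelNodes` ((U3-F) brick P3a, part 1∕2): the SPREAD MODEL `(X + t)(X + T)⋯(X + T^{d−1})`, its nodes
# `−2T^{d−1} < ⋯ < −2T < −2 < 0`, the middle-coefficient perturbation bound, and the lower bounds `|g(x_i)| ≥ T^{md}`, `|g(−2)| ≥ (T∕2)^{d−1}`

R90-TF section S3 (dealer R90-C12-plan (g2), memo `DEAL-S3-U3F-SPLIT.v2.md` row P3; captain's census `R90/S3/CENSUS-U3F-assembly.K2E3-p17-g11.md` §3 (C3));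
crux H413 (`stmt-HodgeConjecture-24833`, lane `--supports … --as helper`), route `HCCMUnconditional`.  Part 1 of the P3a pair; part 2
(`R90S3SpreadModelRealRooted`) draws the conclusions (alternation of every nearby monic `f` with the same constant term, `d` simple negative roots).  PURE
MATHLIB + ★ T3 `R90S3RealRootedOfSignAlternation` (`sign_alternation_prod_X_sub_C`); THEOREMS ONLY (no `def`, no `instance`, no notation, no named fact, no
`sorry`); never imports `Cruxes/…/Lines`.  The model's roots `a : Fin d → ℝ` and the nodes `x : Fin (d+1) → ℝ` are explicit functions WITH DEFINING HYPOTHESES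
(`ha : a j = if j + 1 < d then −T^{d−1−j} else −t`, `hx : x i = if i < d then −2T^{d−1−i} else 0`) — no definition is introduced.

THE MATHEMATICS [folklore].  `T ≥ 4`, `0 < t ≤ 1`.  The nodes increase and interlace the roots (`T > 2`, `t < 2`), so `g := ∏ (X − a_j)` alternates at them (★ T3).
At `x = −2T^m` EVERY factor has `|x − a_j| ≥ T^m` (`2T^m − T^{m′} ≥ T^m` for `m′ ≤ m`; `T^{m′} − 2T^m ≥ T^m` for `m′ > m` as `T ≥ 3`; `2T^m − t ≥ T^m`), so
`|g(x)| ≥ T^{md}`; at `x = −2` the `d − 1` large roots give factors `≥ T∕2` and the small one `≥ 1`, so `|g(−2)| ≥ (T∕2)^{d−1}`.  If `deg f, deg g ≤ d` with equal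
top and constant coefficients and `|f_k − g_k| ≤ B` for `0 < k < d`, then `|f(x) − g(x)| ≤ B (d−1) |x|^{d−1}` for `|x| ≥ 1`.
* §1 `abs_eval_sub_eval_le_of_middle_coeff`.
* §2 `spreadNodes_strictMono`, `spreadRoots_interlace`, **`spreadModel_sign_alternation`**, `abs_spreadNode_sub_spreadRoot_ge`, **`abs_eval_spreadModel_spreadNode_ge`**,
  **`abs_eval_spreadModel_neg_two_ge`**.

HONEST LABEL: HC_CM is proved only modulo the 7 printed citations (2 remaining named inputs: hLiu418 = stmt-HodgeConjecture-24832, h413 =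
stmt-HodgeConjecture-24833) until rung 0 closes; elementary real analysis for a sub-step of a GENUINE residual ((U3-F)); proves nothing printed; count-neutral.
References: [Rogawski1990] §13.8 p. 216 (the auxiliary totally real field); [CasselsFrohlichANT1967] Ch. II §6 (approximation ∕ CRT — the consumer P3b).
-/

set_option autoImplicit false
-- the mandated namespace repeats the single-problem summit's segment (`HodgeConjecture.HodgeConjecture`)
set_option linter.dupNamespace false

noncomputable section

namespace Summit.HodgeConjecture.HodgeConjecture.R90.S3

open Polynomial Finset

/-! ## §1 The middle-coefficient perturbation bound -/

/-- **Middle-coefficient perturbation bound.**  If `deg f, deg g ≤ d`, the top coefficients `f_d = g_d` and the constant terms `f₀ = g₀` agree, and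
`|f_k − g_k| ≤ B` for `0 < k < d`, then `|f(x) − g(x)| ≤ B · (d − 1) · |x|^{d−1}` for every `|x| ≥ 1`. [folklore] -/
theorem abs_eval_sub_eval_le_of_middle_coeff {d : ℕ} (f g : ℝ[X]) (hf : f.natDegree ≤ d) (hg : g.natDegree ≤ d) (htop : f.coeff d = g.coeff d)
    (h0 : f.coeff 0 = g.coeff 0) {B : ℝ} (hB : 0 ≤ B) (hmid : ∀ k, 0 < k → k < d → |f.coeff k - g.coeff k| ≤ B) {x : ℝ} (hx : 1 ≤ |x|) :
    |f.eval x - g.eval x| ≤ B * (d - 1 : ℕ) * |x| ^ (d - 1) := by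
  have hdeg : (f - g).natDegree < d + 1 := Nat.lt_succ_of_le ((natDegree_sub_le f g).trans (max_le hf hg))
  rw [← eval_sub, eval_eq_sum_range' hdeg]
  -- termwise bound: the `k = 0` and `k = d` terms vanish, the middle ones are `≤ B |x|^{d−1}`
  have hterm : ∀ k ∈ range (d + 1), |(f - g).coeff k * x ^ k| ≤ if k ∈ Ioo 0 d then B * |x| ^ (d - 1) else 0 := by
    intro k _
    rw [coeff_sub, abs_mul, abs_pow]
    by_cases hk' : k ∈ Ioo 0 d
    · rw [if_pos hk']
      rw [mem_Ioo] at hk'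
      exact mul_le_mul (hmid k hk'.1 hk'.2) (pow_le_pow_right₀ hx (by omega)) (pow_nonneg (abs_nonneg x) k) hB
    · rw [if_neg hk']
      rw [mem_Ioo, not_and_or, not_lt, not_lt] at hk'
      have hk0 : f.coeff k - g.coeff k = 0 := by
        rcases hk' with hk0 | hkd
        · have : k = 0 := by omega
          rw [this, h0, sub_self]
        · rcases hkd.lt_or_eq with hlt | heq
          · rw [coeff_eq_zero_of_natDegree_lt (hf.trans_lt hlt), coeff_eq_zero_of_natDegree_lt (hg.trans_lt hlt), sub_self]
          · rw [← heq, htop, sub_self]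
      rw [hk0, abs_zero, zero_mul]
  calc |∑ k ∈ range (d + 1), (f - g).coeff k * x ^ k| ≤ ∑ k ∈ range (d + 1), |(f - g).coeff k * x ^ k| := abs_sum_le_sum_abs _ _
    _ ≤ ∑ k ∈ range (d + 1), (if k ∈ Ioo 0 d then B * |x| ^ (d - 1) else 0) := sum_le_sum hterm
    _ = ∑ k ∈ Ioo 0 d, B * |x| ^ (d - 1) := by
        rw [← sum_filter]
        congr 1
        ext k
        simp only [mem_filter, mem_range, mem_Ioo]
        omega
    _ = B * (d - 1 : ℕ) * |x| ^ (d - 1) := by rw [sum_const, Nat.card_Ioo, Nat.sub_zero, nsmul_eq_mul]; ring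

/-! ## §2 The spread model `(X + t)(X + T)⋯(X + T^{d−1})`, its nodes, and the value bounds at the nodes -/

section Model

variable {d : ℕ} {T t : ℝ} (hT : 4 ≤ T) (ht0 : 0 < t) (ht1 : t ≤ 1)
  (a : Fin d → ℝ) (ha : ∀ j : Fin d, a j = if (j : ℕ) + 1 < d then -T ^ (d - 1 - j) else -t)
  (x : Fin (d + 1) → ℝ) (hx : ∀ i : Fin (d + 1), x i = if (i : ℕ) < d then -2 * T ^ (d - 1 - i) else 0)

include hT hx in
/-- **The nodes increase**: `x₀ = −2T^{d−1} < x₁ = −2T^{d−2} < ⋯ < x_{d−1} = −2 < x_d = 0`. [folklore] -/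
theorem spreadNodes_strictMono : StrictMono x := by
  refine Fin.strictMono_iff_lt_succ.2 fun i => ?_
  have hi : ((i.castSucc : Fin (d + 1)) : ℕ) = i := rfl
  have his : ((i.succ : Fin (d + 1)) : ℕ) = i + 1 := rfl
  rw [hx i.castSucc, hx i.succ, hi, his, if_pos i.isLt]
  have hTpos : 0 < T := by linarith
  by_cases h : (i : ℕ) + 1 < d
  · rw [if_pos h]
    have hexp : d - 1 - (i : ℕ) = (d - 1 - (i + 1)) + 1 := by omega
    rw [hexp]
    have := pow_lt_pow_right₀ (show (1 : ℝ) < T by linarith) (Nat.lt_add_one (d - 1 - (i + 1)))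
    linarith
  · rw [if_neg h]
    have : 0 < T ^ (d - 1 - (i : ℕ)) := pow_pos hTpos _
    linarith

include hT ht0 ht1 ha hx in
/-- **The roots interlace the nodes**: `x_j < a_j < x_{j+1}` (`−2T^m < −T^m < −2T^{m−1}` since `T > 2`; `−2 < −t < 0`). [folklore] -/
theorem spreadRoots_interlace (j : Fin d) : x j.castSucc < a j ∧ a j < x j.succ := by
  have hj : ((j.castSucc : Fin (d + 1)) : ℕ) = j := rfl
  have hjs : ((j.succ : Fin (d + 1)) : ℕ) = j + 1 := rfl
  rw [hx j.castSucc, hx j.succ, ha j, hj, hjs, if_pos j.isLt]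
  have hTpos : 0 < T := by linarith
  by_cases h : (j : ℕ) + 1 < d
  · rw [if_pos h, if_pos h]
    have hexp : d - 1 - (j : ℕ) = (d - 1 - (j + 1)) + 1 := by omega
    have hpos : 0 < T ^ (d - 1 - ((j : ℕ) + 1)) := pow_pos hTpos _
    constructor
    · have : 0 < T ^ (d - 1 - (j : ℕ)) := pow_pos hTpos _
      linarith
    · rw [hexp, pow_succ]
      nlinarith
  · rw [if_neg h, if_neg h]
    have hexp : d - 1 - (j : ℕ) = 0 := by omega
    rw [hexp, pow_zero]
    constructor <;> linarith

include hT ht0 ht1 ha hx in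
/-- **The model alternates at the nodes** (★ T3 `sign_alternation_prod_X_sub_C` on the interlacing data). [folklore] -/
theorem spreadModel_sign_alternation (i : Fin d) :
    (∏ j, (X - C (a j))).eval (x i.castSucc) * (∏ j, (X - C (a j))).eval (x i.succ) < 0 :=
  sign_alternation_prod_X_sub_C a x (spreadRoots_interlace hT ht0 ht1 a ha x hx) i

include hT ht1 ha hx in
/-- **Factor bound at a node**: at `x_i = −2T^m` (`m = d − 1 − i`), EVERY factor has `|x_i − a_j| ≥ T^m`. [folklore] -/
theorem abs_spreadNode_sub_spreadRoot_ge (i : Fin (d + 1)) (hi : (i : ℕ) < d) (j : Fin d) : T ^ (d - 1 - (i : ℕ)) ≤ |x i - a j| := by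
  have hT1 : 1 ≤ T := by linarith
  have hTm : 1 ≤ T ^ (d - 1 - (i : ℕ)) := one_le_pow₀ hT1
  rw [hx i, if_pos hi, ha j]
  by_cases h : (j : ℕ) + 1 < d
  · rw [if_pos h]
    rcases lt_trichotomy (d - 1 - (j : ℕ)) (d - 1 - (i : ℕ)) with hlt | heq | hgt
    · -- the root is smaller in size: `|−2T^m + T^{m'}| = 2T^m − T^{m'} ≥ T^m`
      have hle : T ^ (d - 1 - (j : ℕ)) ≤ T ^ (d - 1 - (i : ℕ)) := pow_le_pow_right₀ hT1 hlt.le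
      rw [abs_of_nonpos (by linarith)]
      linarith
    · rw [heq, abs_of_nonpos (by linarith)]
      linarith
    · -- the root is larger in size: `T^{m'} ≥ T^{m+1} ≥ 4 T^m`, so `|−2T^m + T^{m'}| = T^{m'} − 2T^m ≥ T^m`
      have hge : T ^ (d - 1 - (i : ℕ) + 1) ≤ T ^ (d - 1 - (j : ℕ)) := pow_le_pow_right₀ hT1 hgt
      have h4 : 4 * T ^ (d - 1 - (i : ℕ)) ≤ T ^ (d - 1 - (i : ℕ) + 1) := by
        rw [pow_succ]
        nlinarith
      rw [abs_of_nonneg (by linarith)]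
      linarith
  · rw [if_neg h, abs_of_nonpos (by linarith)]
    linarith

include hT ht1 ha hx in
/-- **`|g(x_i)| ≥ (T^m)^d = T^{m d}`** at the node `x_i = −2T^m` (product of the `d` factor bounds). [folklore] -/
theorem abs_eval_spreadModel_spreadNode_ge (i : Fin (d + 1)) (hi : (i : ℕ) < d) :
    (T ^ (d - 1 - (i : ℕ))) ^ d ≤ |(∏ j, (X - C (a j))).eval (x i)| := by
  have hTpos : 0 < T := by linarith
  rw [eval_prod, Finset.abs_prod]
  simp only [eval_sub, eval_X, eval_C]
  calc (T ^ (d - 1 - (i : ℕ))) ^ d = ∏ _j : Fin d, T ^ (d - 1 - (i : ℕ)) := by rw [prod_const, card_univ, Fintype.card_fin]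
    _ ≤ ∏ j, |x i - a j| :=
        prod_le_prod (fun j _ => (pow_pos hTpos _).le) fun j _ => abs_spreadNode_sub_spreadRoot_ge hT ht1 a ha x hx i hi j

include hT ht1 ha hx in
/-- **`|g(−2)| ≥ (T∕2)^{d−1}`** at the last negative node `x_{d−1} = −2`: the `d − 1` large roots give factors `T^{m′} − 2 ≥ T∕2`, the small root gives
`2 − t ≥ 1` (the product over `Fin d = Fin (n+1)` is split off at the last index, Mathlib `Fin.prod_univ_castSucc`). [folklore] -/
theorem abs_eval_spreadModel_neg_two_ge (i : Fin (d + 1)) (hi : (i : ℕ) + 1 = d) :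
    (T / 2) ^ (d - 1) ≤ |(∏ j, (X - C (a j))).eval (x i)| := by
  have hT1 : 1 ≤ T := by linarith
  have hxi : x i = -2 := by
    rw [hx i, if_pos (by omega), show d - 1 - (i : ℕ) = 0 by omega, pow_zero]; norm_num
  -- write `d = n + 1`
  obtain ⟨n, hn⟩ : ∃ n, d = n + 1 := ⟨d - 1, by omega⟩
  subst hn
  rw [eval_prod, Finset.abs_prod, Fin.prod_univ_castSucc, Nat.add_sub_cancel]
  simp only [eval_sub, eval_X, eval_C, hxi]
  -- the large roots
  have hbig : ∀ j : Fin n, T / 2 ≤ |(-2 : ℝ) - a j.castSucc| := by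
    intro j
    have hjv : ((j.castSucc : Fin (n + 1)) : ℕ) = j := rfl
    rw [ha j.castSucc, hjv, if_pos (by omega)]
    have h1 : T ≤ T ^ (n + 1 - 1 - (j : ℕ)) := by
      calc T = T ^ 1 := (pow_one T).symm
        _ ≤ T ^ (n + 1 - 1 - (j : ℕ)) := pow_le_pow_right₀ hT1 (by omega)
    rw [abs_of_nonneg (by linarith)]
    linarith
  -- the small root
  have hsmall : 1 ≤ |(-2 : ℝ) - a (Fin.last n)| := by
    rw [ha (Fin.last n), Fin.val_last, if_neg (lt_irrefl _), abs_of_nonpos (by linarith)]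
    linarith
  calc (T / 2) ^ n = (∏ _j : Fin n, T / 2) * 1 := by rw [prod_const, card_univ, Fintype.card_fin, mul_one]
    _ ≤ (∏ j : Fin n, |(-2 : ℝ) - a j.castSucc|) * |(-2 : ℝ) - a (Fin.last n)| :=
        mul_le_mul (prod_le_prod (fun _ _ => by positivity) fun j _ => hbig j) hsmall zero_le_one
          (prod_nonneg fun _ _ => abs_nonneg _)

end Model

end Summit.HodgeConjecture.HodgeConjecture.R90.S3

end
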